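import Mathlib.MeasureTheory.Integral.Prod
import Mathlib.MeasureTheory.Function.L2Space
import Summits.QuantumFields.QCD.Theorems.QuarksAsStableActionStableActionBridgeStubRayleighLeOfEigenLe
import Summits.QuantumFields.QCD.Theorems.QuarksAsStableActionStableActionBridgeStubEigenRayleigh
import Summits.QuantumFields.QCD.Theorems.QuarksAsStableActionStableActionBridgeStubBondKernelContinuous
import Summits.QuantumFields.QCD.Theorems.QuarksAsStableActionStableActionBridgeTransferPositivity
import Summits.QuantumFields.QCD.Theorems.QuarksAsStableActionStableActionBridgeFermionSliceContinuous
import Literature.Analysis.OperatorTheory.HermitianKernelOperator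
import HarnessLib

/-!
# Stub `stub_eigenwave_to_eigenvector` of line `twisted_trace_transfer`
# for crux `QuarksAsStableAction.StableActionBridge` (item stmt-QuantumFields-9737)

This file proves the registered stub `stub_eigenwave_to_eigenvector` (sub-goal V5b of step E3 of the
lead skeleton of line `twisted_trace_transfer`): **a continuous eigenwave of the transfer map is an
eigenvector of the scalarised transfer operator.**

Step E3 realises Lüscher's QCD transfer matrix (Lüscher, CMP 54 (1977); Smit, *Introduction to
Quantum Fields on a Lattice*, §6.5 (6.87)) as the `L²(Y, ρ)` integral operator `A`,
`Y = SU(3)^{E₃} × Finset(modes)`, `ρ = Haar ⊗ count`, with kernel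
`k((U,s),(U',s')) = (R(U) B(U,U') R(U'))_{s s'}`, where `R` is a continuous pointwise Hermitian
square root of Smit's `T̂_F(U) = fermionSliceOp U mq` and
`B(U,U') = ∫ K_β(U,U'^g) Γ(G_g) dg` is the Gauss-averaged Wilson bond kernel.  The vacuum-parity
lemma of the skeleton moves between eigenvectors of `A` and continuous EIGENWAVES of the `R`-free
transfer map `(𝒯Ψ)(U) = ∫ B(U,U') T̂_F(U') Ψ(U') dU'`; this stub is the direction
eigenwave ⇒ eigenvector: if `Ψ` is continuous with `𝒯Ψ = λΨ`, then the `L²` class `φ` of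
`v(U,s) := (R(U)Ψ(U))_s` satisfies `A φ = λ φ`.

## Proof

`v` has continuous sections `U ↦ v(U,s)`, hence (compact probability space times a finite set)
`v ∈ L²(ρ)`; let `φ := [v]`, so `φ = v` a.e.  For every `y = (U,s)`,
`∫ k(y,y') φ(y') dρ = ∫ k(y,y') v(y') dρ` (the integral does not see the representative)
`= ∫ Σ_{s'} (R(U) B(U,U') R(U'))_{s s'} (R(U')Ψ(U'))_{s'} dU'` (unscalarisation, Fubini for
`Haar ⊗ count`) `= ∫ (R(U) B(U,U') T̂_F(U') Ψ(U'))_s dU'` (`R(U')² = T̂_F(U')`)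
`= Σ_j R(U)_{s j} ∫ (B(U,U') T̂_F(U') Ψ(U'))_j dU'` (finite sums through the integral; the integrand
is continuous on the compact configuration space, `B` being jointly continuous by
`stub_bondKernel_continuous` and `T̂_F` continuous by `continuous_fermionSliceOp`)
`= Σ_j R(U)_{s j} λ Ψ(U)_j = λ v(U,s)` (the eigenwave hypothesis).  With `A φ = ∫ k φ dρ` a.e. and
`(λ • φ) = λ φ = λ v` a.e. we get `A φ = λ φ` a.e., i.e. `A φ = λ • φ` in `L²` (`Lp.ext`).

The analysis is done for an abstract bond kernel with continuous entries on a compact `X`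
(`StubEigenwaveToEigenvector.main_abstract`) and specialised at the end.  Pure theorem file (no
definitions, no notation); helpers live in the sub-namespace `StubEigenwaveToEigenvector`.

[cite: Luscher1977, pp. 283–292] [cite: Smit2023, §6.5 (6.87)] [cite: ReedSimonIV1978, Thm XIII.1]
-/

noncomputable section

namespace Summit.QuantumFields.QCD.Cruxes.StableActionBridge.TwistedTraceTransfer

open MeasureTheory Filter
open scoped InnerProductSpace ComplexConjugate Matrix BigOperators
open Literature.MathematicalPhysics.QuantumFieldTheory Literature.MathematicalPhysics.QuantumLattice
open Literature.Probability.LatticeModels (TorusSite)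

namespace StubEigenwaveToEigenvector

/-- Matrix bookkeeping of the kernel: `Σ_{s'} (R_U B R_{U'})_{s s'} (R_{U'} ψ)_{s'} = Σ_j (R_U)_{s j} ((B T) ψ)_j`
once `R_{U'} R_{U'} = T` (`mulVec_mulVec` and associativity). [folklore] -/
theorem sum_kernel_mul_mulVec {F : Type*} [Fintype F] (Ru Bm Ru' T' : Matrix F F ℂ)
    (hT : Ru' * Ru' = T') (ψ : F → ℂ) (s : F) :
    ∑ s', (Ru * Bm * Ru') s s' * (Ru' *ᵥ ψ) s' = ∑ j, Ru s j * ((Bm * T') *ᵥ ψ) j := by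
  have h1 : ∑ s', (Ru * Bm * Ru') s s' * (Ru' *ᵥ ψ) s' = ((Ru * Bm * Ru') *ᵥ (Ru' *ᵥ ψ)) s := rfl
  have h2 : ∑ j, Ru s j * ((Bm * T') *ᵥ ψ) j = (Ru *ᵥ ((Bm * T') *ᵥ ψ)) s := rfl
  rw [h1, h2, Matrix.mulVec_mulVec, Matrix.mulVec_mulVec, Matrix.mul_assoc (Ru * Bm), hT,
    Matrix.mul_assoc]

/-! ### The stub for an abstract bond kernel

`X` is a compact configuration space carrying a finite measure `μ`, `F` a finite index type,
`R, T : X → Matrix F F ℂ` continuous with `R(U)² = T(U)`, and `B : X → X → Matrix F F ℂ` has jointly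
continuous entries. -/

section Abstract

variable {X : Type*} [TopologicalSpace X] [CompactSpace X] [MeasurableSpace X] [OpensMeasurableSpace X]
  {μ : Measure X} [IsFiniteMeasure μ]
  {F : Type*} [Fintype F] [MeasurableSpace F] [MeasurableSingletonClass F]

/-- **Eigenwave ⇒ eigenvector, abstract bond kernel.**  If `A` on `L²(μ ⊗ count)` is given a.e. by
the kernel `k((U,s),(U',s')) = (R(U) B(U,U') R(U'))_{s s'}` and the continuous wave `Ψ` satisfies
`∫ B(U,U') T(U') Ψ(U') dμ(U') = λ Ψ(U)` (`R(U)² = T(U)`), then the `L²` class `φ` of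
`(U,s) ↦ (R(U)Ψ(U))_s` satisfies `A φ = λ φ`. [cite: Luscher1977, pp. 283–292] -/
theorem main_abstract
    {R : X → Matrix F F ℂ} (hRc : Continuous R)
    {B : X → X → Matrix F F ℂ} (hBc : ∀ a c, Continuous fun p : X × X => B p.1 p.2 a c)
    {T : X → Matrix F F ℂ} (hTc : Continuous T) (hT : ∀ U, R U * R U = T U)
    {k : X × F → X × F → ℂ} (hk : ∀ y y', k y y' = (R y.1 * B y.1 y'.1 * R y'.1) y.2 y'.2)
    {A : Lp ℂ 2 (μ.prod (Measure.count : Measure F)) →L[ℂ] Lp ℂ 2 (μ.prod (Measure.count : Measure F))}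
    (hA : ∀ φ : Lp ℂ 2 (μ.prod (Measure.count : Measure F)),
      (A φ : X × F → ℂ) =ᵐ[μ.prod (Measure.count : Measure F)]
        fun y => ∫ y', k y y' * φ y' ∂(μ.prod (Measure.count : Measure F)))
    {Ψ : X → F → ℂ} (hΨ : Continuous Ψ) {lam : ℝ}
    (heig : ∀ U a, ∫ U', ((B U U' * T U') *ᵥ Ψ U') a ∂μ = (lam : ℂ) * Ψ U a) :
    ∃ φ : Lp ℂ 2 (μ.prod (Measure.count : Measure F)),
      ((φ : X × F → ℂ) =ᵐ[μ.prod (Measure.count : Measure F)] fun y => (R y.1 *ᵥ Ψ y.1) y.2) ∧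
        A φ = (lam : ℂ) • φ := by
  -- the scalarised wave `v(U,s) = (R(U)Ψ(U))_s` has continuous sections, hence is in `L²`
  have hvs : ∀ s : F, Continuous fun U => (R U *ᵥ Ψ U) s :=
    fun s => (continuous_apply s).comp' (hRc.matrix_mulVec hΨ)
  have hv : MemLp (fun y : X × F => (R y.1 *ᵥ Ψ y.1) y.2) 2 (μ.prod (Measure.count : Measure F)) :=
    StubRayleighLeOfEigenLe.memLp_two_prod_count hvs
  refine ⟨hv.toLp _, hv.coeFn_toLp, ?_⟩
  -- sections of the kernel in the second variable are continuous
  have hkU : ∀ (y : X × F) (s' : F), Continuous fun U' => k y (U', s') := fun y s' => by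
    have h := ((StubEigenRayleigh.continuous_RBR hRc hBc).matrix_elem y.2 s').comp'
      (Continuous.prodMk_right (Y := X) y.1)
    simp only [hk]
    exact h
  -- `B(U, ·)` is continuous, so the transfer-map integrand is continuous, hence integrable
  have hBU : ∀ U : X, Continuous fun U' => B U U' := fun U =>
    continuous_matrix fun a c => (hBc a c).comp' (Continuous.prodMk_right (Y := X) U)
  have hI : ∀ (U : X) (j : F), Integrable (fun U' => ((B U U' * T U') *ᵥ Ψ U') j) μ := fun U j =>
    StubRayleighOfInvariant.integrable_of_continuous
      ((continuous_apply j).comp' (((hBU U).mul hTc).matrix_mulVec hΨ))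
  -- pointwise: `∫ k((U,s), y') φ(y') dρ(y') = λ v(U,s)`
  have hpt : ∀ (U : X) (s : F),
      ∫ y', k (U, s) y' * (hv.toLp _ : X × F → ℂ) y' ∂(μ.prod (Measure.count : Measure F)) =
        (lam : ℂ) * (R U *ᵥ Ψ U) s := fun U s => by
    calc ∫ y', k (U, s) y' * (hv.toLp _ : X × F → ℂ) y' ∂(μ.prod (Measure.count : Measure F))
        = ∫ y', k (U, s) y' * (R y'.1 *ᵥ Ψ y'.1) y'.2 ∂(μ.prod (Measure.count : Measure F)) :=
          integral_congr_ae (hv.coeFn_toLp.mono fun y' hy' => by simp only [hy'])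
      _ = ∫ U', ∑ s', k (U, s) (U', s') * (R U' *ᵥ Ψ U') s' ∂μ :=
          StubRayleighLeOfEigenLe.integral_prod_count
            (f := fun y' => k (U, s) y' * (R y'.1 *ᵥ Ψ y'.1) y'.2) fun s' => (hkU (U, s) s').mul (hvs s')
      _ = ∫ U', ∑ j, R U s j * ((B U U' * T U') *ᵥ Ψ U') j ∂μ := by
          refine integral_congr_ae (Eventually.of_forall fun U' => ?_)
          simp only [hk]
          exact sum_kernel_mul_mulVec _ _ _ _ (hT U') _ _
      _ = ∑ j, R U s j * ∫ U', ((B U U' * T U') *ᵥ Ψ U') j ∂μ :=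
          (StubEigenRayleigh.sum_mul_integral _ (hI U)).symm
      _ = (lam : ℂ) * (R U *ᵥ Ψ U) s := by
          simp only [heig]
          simp only [Matrix.mulVec, dotProduct, Finset.mul_sum]
          exact Finset.sum_congr rfl fun j _ => by ring
  -- assemble: `A φ = λ φ` almost everywhere, hence in `L²`
  refine Lp.ext ?_
  filter_upwards [hA (hv.toLp _), Lp.coeFn_smul (lam : ℂ) (hv.toLp _), hv.coeFn_toLp]
    with ⟨U, s⟩ hAy hsy hvy
  rw [hAy, hsy, Pi.smul_apply, smul_eq_mul, hvy]
  exact hpt U s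

end Abstract

end StubEigenwaveToEigenvector

open StubEigenwaveToEigenvector

/-- **Sub-goal V5b of step E3 (registered stub `stub_eigenwave_to_eigenvector`): a continuous
eigenwave `Ψ` of the transfer map `(𝒯Ψ)(U) = ∫ B(U,U') T̂_F(U') Ψ(U') dU'` gives the eigenvector
`[RΨ]` of the scalarised transfer operator with the same eigenvalue** — for the `L²(Haar ⊗ count)`
integral operator `A` of `k((U,s),(U',s')) = (R(U) B(U,U') R(U'))_{s s'}`,
`A [RΨ] = ∫ k [RΨ] = R ∫ B T̂_F Ψ = λ RΨ` a.e. (`StubEigenwaveToEigenvector.main_abstract` with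
`B` the Gauss-averaged Wilson bond kernel, jointly continuous by `stub_bondKernel_continuous`, and
`T̂_F` continuous by `continuous_fermionSliceOp`). [cite: Luscher1977, pp. 283–292] -/
theorem stub_eigenwave_to_eigenvector : ∀ (Nf S : ℕ) [NeZero S] (β : ℝ) (mq : Fin Nf → ℝ), (∀ f, -1 < mq f) →
    ∀ R : GaugeConfig 3 S (Matrix.specialUnitaryGroup (Fin 3) ℂ) → Matrix (Finset (SliceFermiIdx Nf S)) (Finset (SliceFermiIdx Nf S)) ℂ,
    Continuous R → (∀ U, (R U)ᴴ = R U ∧ R U * R U = fermionSliceOp U mq) →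
    ∀ k : GaugeConfig 3 S (Matrix.specialUnitaryGroup (Fin 3) ℂ) × Finset (SliceFermiIdx Nf S) → GaugeConfig 3 S (Matrix.specialUnitaryGroup (Fin 3) ℂ) × Finset (SliceFermiIdx Nf S) → ℂ,
    (∀ y y', k y y' = (R y.1 * (Matrix.of fun a c => ∫ g : TorusSite 3 S → (Matrix.specialUnitaryGroup (Fin 3) ℂ),
            (gaugeSliceKernel β y.1 (gaugeTransform g y'.1) : ℂ) * @fockGaugeAct Nf S _ g a c
              ∂(Measure.pi fun _ => haarProbability (Matrix.specialUnitaryGroup (Fin 3) ℂ))) * R y'.1) y.2 y'.2) →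
    ∀ A : Lp ℂ 2 ((sliceHaar S).prod (Measure.count : Measure (Finset (SliceFermiIdx Nf S)))) →L[ℂ]
        Lp ℂ 2 ((sliceHaar S).prod (Measure.count : Measure (Finset (SliceFermiIdx Nf S)))),
      (∀ φ : Lp ℂ 2 ((sliceHaar S).prod (Measure.count : Measure (Finset (SliceFermiIdx Nf S)))),
        (A φ : GaugeConfig 3 S (Matrix.specialUnitaryGroup (Fin 3) ℂ) × Finset (SliceFermiIdx Nf S) → ℂ)
          =ᵐ[(sliceHaar S).prod (Measure.count : Measure (Finset (SliceFermiIdx Nf S)))]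
          fun y => ∫ y', k y y' * φ y' ∂((sliceHaar S).prod (Measure.count : Measure (Finset (SliceFermiIdx Nf S))))) →
    ∀ (Ψ : SliceWave Nf S) (lam : ℝ), Continuous Ψ →
      (∀ (U : GaugeConfig 3 S (Matrix.specialUnitaryGroup (Fin 3) ℂ)) (a : Finset (SliceFermiIdx Nf S)),
        (∫ U', (((Matrix.of fun a' c => ∫ g : TorusSite 3 S → (Matrix.specialUnitaryGroup (Fin 3) ℂ),
            (gaugeSliceKernel β U (gaugeTransform g U') : ℂ) * @fockGaugeAct Nf S _ g a' c
              ∂(Measure.pi fun _ => haarProbability (Matrix.specialUnitaryGroup (Fin 3) ℂ))) * fermionSliceOp U' mq) *ᵥ Ψ U') a ∂(sliceHaar S)) = (lam : ℂ) * Ψ U a) →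
      ∃ φ : Lp ℂ 2 ((sliceHaar S).prod (Measure.count : Measure (Finset (SliceFermiIdx Nf S)))),
        ((φ : GaugeConfig 3 S (Matrix.specialUnitaryGroup (Fin 3) ℂ) × Finset (SliceFermiIdx Nf S) → ℂ)
          =ᵐ[(sliceHaar S).prod (Measure.count : Measure (Finset (SliceFermiIdx Nf S)))]
          fun y => (R y.1 *ᵥ Ψ y.1) y.2) ∧ A φ = (lam : ℂ) • φ := by
  intro Nf S _ β mq hm R hRc hR k hk A hA Ψ lam hΨ heig
  haveI := Sketch.isProbabilityMeasure_sliceHaar S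
  refine main_abstract (μ := sliceHaar S)
    (B := fun U U' => Matrix.of fun a c => ∫ g : TorusSite 3 S → (Matrix.specialUnitaryGroup (Fin 3) ℂ),
      (gaugeSliceKernel β U (gaugeTransform g U') : ℂ) * @fockGaugeAct Nf S _ g a c
        ∂(Measure.pi fun _ => haarProbability (Matrix.specialUnitaryGroup (Fin 3) ℂ)))
    hRc ?_ (Sketch.continuous_fermionSliceOp Nf S mq hm) (fun U => (hR U).2) ?_ hA hΨ ?_
  · intro a c
    simpa only [Matrix.of_apply] using stub_bondKernel_continuous Nf S β a c
  · exact hk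
  · exact heig

end Summit.QuantumFields.QCD.Cruxes.StableActionBridge.TwistedTraceTransfer

end
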